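import Mathlib
import HarnessLib
import Literature.NumberTheory.Automorphic.WeightOneDescent
import Literature.NumberTheory.Automorphic.CertifiedMaassHeckeTraceCensus
import Summits.Langlands.Langlands.Theorems.QuarterDeficit1951CorrespondentFingerprintStubDescentAux2

/-!
# Crux `CorrespondentFingerprint` (stmt-Langlands-15898), line `Sketch`, stub `stub_descent`:
# auxiliary file 4 — the unramified Hecke operators descend (`T_{v,1} ↦ √p T_p`, `T_{v,2} ↦ χ₁(p)`)

For a `K₁(N)`-fixed cusp form `φ₀` on `GL₂(𝔸_ℚ)` of central character `ψ_{χ₁}`, `SO(2)`-weight `0`,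
killed by `Z`, `u(τ) = φ₀((g_τ, 1))`, and `v = p ∤ N`: `T_{v,1} = [K(N) diag(ϖ,1)_v K(N)]` at
`(g_τ, 1)` is `∑_{b mod p} u((τ+b)/p) + χ₁(p) u(pτ) = √p (T_p u)(τ)` (Gelbart 1975, Lemma 3.7, via
the representatives `yⱼ` and rational matrices `βⱼ` of `NewformAdelisationHecke`), and
`T_{v,2} = r(diag(ϖ,ϖ)_v)` acts by `ψ_{χ₁}(⟨ϖ⟩_v) = χ₁(p)`; registered sub-goal `stub_descent_hecke`.
Theorems only; no `sorry`.
-/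

set_option linter.dupNamespace false

noncomputable section

open scoped MatrixGroups Matrix NumberField Classical ModularForm
open Literature.NumberTheory.Automorphic Literature.NumberTheory.GaloisRepresentations
  IsDedekindDomain NumberField
open Literature.NumberTheory.Automorphic.GL2Real
open UpperHalfPlane Rat.HeightOneSpectrum IsDedekindDomain.HeightOneSpectrum
open Literature.NumberTheory.EllipticCurves.ModularForms CongruenceSubgroup

namespace Summit.Langlands.Langlands.Theorems.CorrespondentFingerprint

section Hecke

variable {hcpt : isCompact_glFiniteIntegralLevel 2 ℚ} {N : ℕ} [NeZero N]
  {φ₀ : (AdelicGroupData.gl 2 ℚ).Adelic → ℂ} {v : HeightOneSpectrum (𝓞 ℚ)}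

omit [NeZero N] in
/-- `φ₀` is a `K(N)`-fixed vector of the right regular action (`K(N) ≤ {1} × K₁(N)`). [folklore] -/
theorem mem_fixedPoints_principalCongruenceLevel
    (hK : ∀ u ∈ gammaOneFiniteLevel ℚ (Ideal.span {(N : 𝓞 ℚ)}),
      rightTranslation (AdelicGroupData.gl 2 ℚ) (show (AdelicGroupData.gl 2 ℚ).Adelic from GLn.ofFinite 2 ℚ u) φ₀ = φ₀) :
    φ₀ ∈ (rightTranslation (AdelicGroupData.gl 2 ℚ)).fixedPoints
      (show Subgroup (AdelicGroupData.gl 2 ℚ).Adelic from principalCongruenceLevel 2 ℚ (Ideal.span {(N : 𝓞 ℚ)})) := by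
  rw [Representation.mem_fixedPoints]
  intro u hu
  funext g
  exact apply_mul_of_mem_gammaOneLevel hK
    (mem_gammaOneLevel_iff.2 ⟨(mem_glIntegralLevel_iff.1 (principalCongruenceLevel_le 2 ℚ _ hu)).2,
      Rat.sndHom_mem_gammaOneFiniteLevel_of_mem_principalCongruenceLevel hu⟩) g

omit [NeZero N] in
/-- **An element of `GL₂(ℝ)⁺ × K₁(N)` evaluates through its archimedean part**: `φ₀(h) = φ₀((h_∞, 1))`.
[cite: Gelbart1975, §3.A, (3.1)] -/
theorem apply_eq_apply_ofRealGL_archGL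
    (hK : ∀ u ∈ gammaOneFiniteLevel ℚ (Ideal.span {(N : 𝓞 ℚ)}),
      rightTranslation (AdelicGroupData.gl 2 ℚ) (show (AdelicGroupData.gl 2 ℚ).Adelic from GLn.ofFinite 2 ℚ u) φ₀ = φ₀)
    {h : GL (Fin 2) (AdeleRing (𝓞 ℚ) ℚ)} (hh : h ∈ Rat.plusLevelOne (Ideal.span {(N : 𝓞 ℚ)})) :
    φ₀ h = φ₀ (Rat.ofRealGL 2 (Rat.archGL 2 h)) := by
  conv_lhs => rw [← mul_inv_cancel_left (Rat.ofRealGL 2 (Rat.archGL 2 h)) h]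
  exact apply_mul_of_mem_gammaOneLevel hK (Rat.ofRealGL_archGL_inv_mul_mem_gammaOneLevel hh) _

omit [NeZero N] in
/-- **The value `φ₀((g_∞, 1) y)` through a matching rational matrix** (Gelbart 1975, proof of
Lemma 3.7): if `det β > 0`, `y` has trivial archimedean part and `β⁻¹ y_w ∈ K₁(N)_w` for all `w`,
then `φ₀((g_∞, 1) y) = φ₀((β⁻¹ g_∞, 1))`. [cite: Gelbart1975, Lemma 3.7 (proof)] -/
theorem apply_ofRealGL_mul_eq_of_matching (hcusp : φ₀ ∈ cuspFormsGL 2 ℚ hcpt)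
    (hK : ∀ u ∈ gammaOneFiniteLevel ℚ (Ideal.span {(N : 𝓞 ℚ)}),
      rightTranslation (AdelicGroupData.gl 2 ℚ) (show (AdelicGroupData.gl 2 ℚ).Adelic from GLn.ofFinite 2 ℚ u) φ₀ = φ₀)
    {g : GL (Fin 2) ℝ} (hg : 0 < g.det.val) {β : GL (Fin 2) ℚ} (hβ : 0 < (β.det : ℚ))
    {y : GL (Fin 2) (AdeleRing (𝓞 ℚ) ℚ)} (hy : Rat.archGL 2 y = 1)
    (hβy : ∀ w : HeightOneSpectrum (𝓞 ℚ),
      Rat.globalToLocal 2 w β⁻¹ * GLn.localPart 2 ℚ w y ∈ Rat.localGammaOne w (Ideal.span {(N : 𝓞 ℚ)})) :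
    φ₀ (Rat.ofRealGL 2 g * y) = φ₀ (Rat.ofRealGL 2 ((Matrix.GeneralLinearGroup.map (Rat.castHom ℝ) β)⁻¹ * g)) := by
  have harch : Rat.archGL 2 ((GLn.ofGlobal 2 ℚ β)⁻¹ * (Rat.ofRealGL 2 g * y)) =
      (Matrix.GeneralLinearGroup.map (Rat.castHom ℝ) β)⁻¹ * g := by
    rw [map_mul, map_inv, map_mul, Rat.archGL_ofGlobal, Rat.archGL_ofRealGL, hy, mul_one]
  have hmem : (GLn.ofGlobal 2 ℚ β)⁻¹ * (Rat.ofRealGL 2 g * y) ∈ Rat.plusLevelOne (Ideal.span {(N : 𝓞 ℚ)}) := by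
    rw [Rat.mem_plusLevelOne_iff_forall_toLocal, harch]
    refine ⟨?_, fun w => ?_⟩
    · rw [map_mul, map_inv, Units.val_mul, Units.val_inv_eq_inv_val,
        Matrix.GeneralLinearGroup.map_det, Units.coe_map, MonoidHom.coe_coe, Rat.coe_castHom]
      exact mul_pos (inv_pos.2 (by exact_mod_cast hβ)) hg
    · rw [map_mul, map_inv, map_mul, GLn.localPart_ofGlobal, GLn.localPart_ofRealGL, one_mul]
      exact hβy w
  rw [← apply_ofGlobal_mul_of_mem_cuspFormsGL hcusp β⁻¹ (Rat.ofRealGL 2 g * y), map_inv,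
    apply_eq_apply_ofRealGL_archGL hK hmem, harch]

/-- **The central Hecke element is the scalar matrix of the uniformizer idele**:
`diag(ϖ, ϖ)_v = ⟨ϖ⟩_v · 1₂`. [folklore] -/
theorem heckeDiagAt_two_eq_scalar_localUnits (ϖ : (v.adicCompletion ℚ)ˣ) :
    heckeDiagAt 2 ℚ v ϖ 2 = Matrix.GeneralLinearGroup.scalar (Fin 2) (localUnits v ϖ) := by
  have hfin : (uniformizerIdele ℚ v ϖ : FiniteAdeleRing (𝓞 ℚ) ℚ) = finiteAdeleSingle v (ϖ : v.adicCompletion ℚ) := by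
    refine FiniteAdeleRing.ext _ fun w => ?_
    by_cases hw : w = v
    · subst hw; rw [uniformizerIdele_apply_self, finiteAdeleSingle_apply_self]
    · rw [uniformizerIdele_apply_of_ne (h := hw), finiteAdeleSingle_apply_of_ne _ hw]
  refine Matrix.GeneralLinearGroup.ext fun i j => ?_
  rw [heckeDiagAt, coe_glDiagonal, Matrix.GeneralLinearGroup.coe_scalar, Matrix.scalar_apply, Matrix.diagonal_apply,
    Matrix.diagonal_apply]
  by_cases hij : i = j
  · rw [if_pos hij, if_pos hij, if_pos i.2]
    change ((1 : InfiniteAdeleRing ℚ), (uniformizerIdele ℚ v ϖ : FiniteAdeleRing (𝓞 ℚ) ℚ)) =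
      ((1 : InfiniteAdeleRing ℚ), finiteAdeleSingle v (ϖ : v.adicCompletion ℚ))
    rw [hfin]
  · rw [if_neg hij, if_neg hij]

/-- **`ψ_{χ}(⟨ϖ_p⟩_p) = χ(p)` for `p ∤ N`** (value form of `valueAtUniformizer_ofDirichlet`). [folklore] -/
theorem ofDirichlet_localUnits_localUniformizer (χ₁ : DirichletCharacter ℂ N) (hv : ¬ v.asIdeal ∣ Ideal.span {(N : 𝓞 ℚ)}) :
    ((HeckeCharacter.ofDirichlet χ₁ (localUnits v (Rat.localUniformizer v)) : ℂˣ) : ℂ) =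
      χ₁ ((natGenerator v : ℕ) : ZMod N) := by
  have hpN : ¬ natGenerator v ∣ N := fun h => hv ((Rat.natGenerator_dvd_iff v N).1 h)
  rw [show Rat.localUniformizer v = Rat.primeLocalUnit v from Units.ext rfl, HeckeCharacter.ofDirichlet_apply, Rat.rayClassHom_localUnits_primeLocalUnit N hpN,
    ← map_inv, inv_inv, MulChar.coe_toUnitHom, ZMod.coe_unitOfCoprime]

/-- **`T_{v,2}` acts on `φ₀` by `χ₁(p)`**: the central Hecke operator `[K(N) diag(ϖ,ϖ)_v K(N)]` is
`r(⟨ϖ⟩_v · 1₂)` on `K(N)`-fixed vectors, and the centre acts through `ψ_{χ₁}` with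
`ψ_{χ₁}(⟨ϖ⟩_v) = χ₁(p)`. [cite: Bump1997, §3.6, (6.4)] [cite: Gelbart1975, (3.15)] -/
theorem heckeOperator_two_eq_smul (χ₁ : DirichletCharacter ℂ N)
    (hK : ∀ u ∈ gammaOneFiniteLevel ℚ (Ideal.span {(N : 𝓞 ℚ)}),
      rightTranslation (AdelicGroupData.gl 2 ℚ) (show (AdelicGroupData.gl 2 ℚ).Adelic from GLn.ofFinite 2 ℚ u) φ₀ = φ₀)
    (hcen : ∀ z : ideleGroup ℚ,
      rightTranslation (AdelicGroupData.gl 2 ℚ) (Matrix.GeneralLinearGroup.scalar (Fin 2) z) φ₀ =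
        ((HeckeCharacter.ofDirichlet χ₁ z : ℂˣ) : ℂ) • φ₀)
    (hv : ¬ v.asIdeal ∣ Ideal.span {(N : 𝓞 ℚ)}) :
    heckeOperator (rightTranslation (AdelicGroupData.gl 2 ℚ))
        (show Subgroup (AdelicGroupData.gl 2 ℚ).Adelic from principalCongruenceLevel 2 ℚ (Ideal.span {(N : 𝓞 ℚ)}))
        (heckeDiagAt 2 ℚ v (Rat.localUniformizer v) 2) φ₀ = (χ₁ ((natGenerator v : ℕ) : ZMod N)) • φ₀ := by
  set Kn : Subgroup (AdelicGroupData.gl 2 ℚ).Adelic := principalCongruenceLevel 2 ℚ (Ideal.span {(N : 𝓞 ℚ)}) with hKn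
  rw [heckeOperator_apply_of_mem_center _ Kn (heckeDiagAt_self_mem_center (n := 2) v (Rat.localUniformizer v))
    (mem_fixedPoints_principalCongruenceLevel hK)]
  change rightTranslation (AdelicGroupData.gl 2 ℚ) (heckeDiagAt 2 ℚ v (Rat.localUniformizer v) 2) φ₀ = _
  rw [heckeDiagAt_two_eq_scalar_localUnits, hcen, ofDirichlet_localUnits_localUniformizer χ₁ hv]

end Hecke

/-! ### The classical points `(τ + j)/p`, `p τ` and translation invariance of `u` -/

section Classical

variable (p : ℕ) [NeZero p]

/-- `diag(p, 1) · τ = p τ`. [folklore] -/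
theorem tpD_smul_eq (τ : ℍ) : (tpD p : GL (Fin 2) ℝ) • τ = ofComplex ((p : ℂ) * (τ : ℂ)) := by
  have hp : (0 : ℝ) < p := Nat.cast_pos.mpr (NeZero.pos p)
  have hdet : 0 < (tpD p : GL (Fin 2) ℝ).det.val := by
    rw [Matrix.GeneralLinearGroup.val_det_apply, val_tpD, Matrix.det_fin_two_of]; simp [hp]
  have him : 0 < ((p : ℂ) * (τ : ℂ)).im := by
    rw [Complex.mul_im, Complex.natCast_re, Complex.natCast_im, zero_mul, add_zero]
    exact mul_pos hp τ.im_pos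
  apply UpperHalfPlane.ext
  rw [coe_smul_of_det_pos hdet, ofComplex_apply_of_im_pos him]
  change UpperHalfPlane.num (tpD p) τ / UpperHalfPlane.denom (tpD p) τ = (p : ℂ) * (τ : ℂ)
  rw [UpperHalfPlane.num, UpperHalfPlane.denom, val_tpD]
  simp

/-- `(1 j; 0 p) · τ = (τ + j)/p`. [folklore] -/
theorem tpB_smul_eq (j : ℤ) (τ : ℍ) : (tpB p j : GL (Fin 2) ℝ) • τ = ofComplex (((τ : ℂ) + j) / p) := by
  have hp : (0 : ℝ) < p := Nat.cast_pos.mpr (NeZero.pos p)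
  have hdet : 0 < (tpB p j : GL (Fin 2) ℝ).det.val := by
    rw [Matrix.GeneralLinearGroup.val_det_apply, val_tpB, Matrix.det_fin_two_of]; simp [hp]
  have him : 0 < (((τ : ℂ) + j) / p).im := by
    rw [Complex.div_natCast_im, Complex.add_im, Complex.intCast_im, add_zero]
    exact div_pos τ.im_pos hp
  apply UpperHalfPlane.ext
  rw [coe_smul_of_det_pos hdet, ofComplex_apply_of_im_pos him]
  change UpperHalfPlane.num (tpB p j) τ / UpperHalfPlane.denom (tpB p j) τ = ((τ : ℂ) + j) / p
  rw [UpperHalfPlane.num, UpperHalfPlane.denom, val_tpB]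
  simp

/-- `(1 y; 0 p) = T^t (1 x; 0 p)` for `y = x + t p`. [folklore] -/
theorem tpB_eq_mapGL_T_zpow_mul {x y t : ℤ} (ht : y - x = p * t) :
    tpB p y = Matrix.SpecialLinearGroup.mapGL ℝ (ModularGroup.T ^ t) * tpB p x := by
  ext i j
  rw [Units.val_mul, val_mapGL', ModularGroup.coe_T_zpow, val_tpB, val_tpB]
  have hy : (y : ℝ) = x + t * p := by
    have : (y : ℤ) = x + p * t := by linarith
    rw [this]; push_cast; ring
  fin_cases i <;> fin_cases j <;> simp [Matrix.mul_apply, Fin.sum_univ_two, hy]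

variable {p}
variable {N : ℕ} {χ₁ : DirichletCharacter ℂ N} {u : ℍ → ℂ}

/-- A function with nebentypus on `Γ₀(N)` is invariant under the translations `T^t`. [folklore] -/
theorem apply_T_zpow_smul
    (hslash : ∀ γ : SL(2, ℤ), γ ∈ CongruenceSubgroup.Gamma0 N → ∀ z : ℍ,
      u (γ • z) = χ₁ (((γ : Matrix (Fin 2) (Fin 2) ℤ) 1 1 : ℤ) : ZMod N) * u z)
    (t : ℤ) (z : ℍ) : u (ModularGroup.T ^ t • z) = u z := by
  have hmem : ModularGroup.T ^ t ∈ CongruenceSubgroup.Gamma0 N := by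
    rw [CongruenceSubgroup.Gamma0_mem, ModularGroup.coe_T_zpow]
    simp
  rw [hslash _ hmem z, ModularGroup.coe_T_zpow]
  simp

/-- **Congruent translations give the same value**: `u((1 x; 0 p) z) = u((1 y; 0 p) z)` for
`p ∣ y - x` (`(1 y; 0 p) = T^{(y-x)/p} (1 x; 0 p)`). [folklore] -/
theorem apply_tpB_smul_congr
    (hslash : ∀ γ : SL(2, ℤ), γ ∈ CongruenceSubgroup.Gamma0 N → ∀ z : ℍ,
      u (γ • z) = χ₁ (((γ : Matrix (Fin 2) (Fin 2) ℤ) 1 1 : ℤ) : ZMod N) * u z)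
    {x y : ℤ} (hxy : (p : ℤ) ∣ y - x) (z : ℍ) : u ((tpB p x : GL (Fin 2) ℝ) • z) = u ((tpB p y : GL (Fin 2) ℝ) • z) := by
  obtain ⟨t, ht⟩ := hxy
  rw [tpB_eq_mapGL_T_zpow_mul p ht, mul_smul]
  exact (apply_T_zpow_smul hslash t _).symm

/-- Reindexing `j ↦ -j (mod p)`: `∑_{j<p} u((1 -j; 0 p) z) = ∑_{j<p} u((1 j; 0 p) z)`. [folklore] -/
theorem sum_apply_tpB_neg_smul
    (hslash : ∀ γ : SL(2, ℤ), γ ∈ CongruenceSubgroup.Gamma0 N → ∀ z : ℍ,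
      u (γ • z) = χ₁ (((γ : Matrix (Fin 2) (Fin 2) ℤ) 1 1 : ℤ) : ZMod N) * u z) (z : ℍ) :
    ∑ j : Fin p, u ((tpB p (-((j : ℕ) : ℤ)) : GL (Fin 2) ℝ) • z) = ∑ j : Fin p, u ((tpB p ((j : ℕ) : ℤ) : GL (Fin 2) ℝ) • z) := by
  have h : ∀ j : Fin p, u ((tpB p (-((j : ℕ) : ℤ)) : GL (Fin 2) ℝ) • z) =
      u ((tpB p (((-j : Fin p) : ℕ) : ℤ) : GL (Fin 2) ℝ) • z) := fun j => by
    refine apply_tpB_smul_congr hslash ?_ z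
    have hsum : (((-j + j : Fin p) : ℕ) : ℤ) = 0 := by rw [neg_add_cancel]; simp
    rw [Fin.val_add] at hsum
    have hdvd : (p : ℤ) ∣ (((-j : Fin p) : ℕ) : ℤ) + j := by
      have h1 : (((((-j : Fin p) : ℕ) + (j : ℕ)) % p : ℕ) : ℤ) = 0 := hsum
      have h2 := Nat.div_add_mod (((-j : Fin p) : ℕ) + (j : ℕ)) p
      refine ⟨((((-j : Fin p) : ℕ) + (j : ℕ)) / p : ℕ), ?_⟩
      have h3 : (((((-j : Fin p) : ℕ) + (j : ℕ)) % p : ℕ)) = 0 := by exact_mod_cast h1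
      rw [h3, add_zero] at h2
      exact_mod_cast h2.symm
    simpa [sub_neg_eq_add] using hdvd
  simp_rw [h]
  exact Equiv.sum_comp (Equiv.neg (Fin p)) (fun j : Fin p => u ((tpB p ((j : ℕ) : ℤ) : GL (Fin 2) ℝ) • z))

end Classical

/-! ### `T_{v,1}` at `(g_τ, 1)`: Gelbart's Lemma 3.7 for the weight-`0` vector -/

section HeckeOne

variable {hcpt : isCompact_glFiniteIntegralLevel 2 ℚ} {N : ℕ} [NeZero N]
  {φ₀ : (AdelicGroupData.gl 2 ℚ).Adelic → ℂ} {v : HeightOneSpectrum (𝓞 ℚ)}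

/-- **Gelbart's Lemma 3.7 at the archimedean points, weight `0`**: for `v = p ∤ N`,
`∑ⱼ φ₀((g_τ, 1) yⱼ) = ∑_{b mod p} u((τ + b)/p) + χ₁(p) u(p τ)` over the `p + 1` representatives
`yⱼ` of `K_p diag(p,1) K_p / K_p` placed at `p` (`φ₀((g_τ,1) yⱼ) = φ₀((βⱼ⁻¹ g_τ, 1)) = u(βⱼ⁻¹ τ)`,
`βⱼ⁻¹ τ = (τ - j)/p` for `j < p` and `β_∞⁻¹ τ = δ⁻¹ (p τ)` with `δ⁻¹ ∈ Γ₀(N)` of lower right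
entry `a ≡ p`). [cite: Gelbart1975, Lemma 3.7] [cite: Bump1997, §3.6, p. 342] -/
theorem sum_apply_ofRealGL_mul_heckeLocalRep (χ₁ : DirichletCharacter ℂ N) (hcusp : φ₀ ∈ cuspFormsGL 2 ℚ hcpt)
    (hK : ∀ u ∈ gammaOneFiniteLevel ℚ (Ideal.span {(N : 𝓞 ℚ)}),
      rightTranslation (AdelicGroupData.gl 2 ℚ) (show (AdelicGroupData.gl 2 ℚ).Adelic from GLn.ofFinite 2 ℚ u) φ₀ = φ₀)
    (hcen : ∀ z : ideleGroup ℚ,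
      rightTranslation (AdelicGroupData.gl 2 ℚ) (Matrix.GeneralLinearGroup.scalar (Fin 2) z) φ₀ =
        ((HeckeCharacter.ofDirichlet χ₁ z : ℂˣ) : ℂ) • φ₀)
    (hs : IsArchSmooth Rat.iotaA φ₀) (hw : IsWeightVec Rat.iotaA 0 φ₀) (hZ : lieDeriv Rat.iotaA (toLie 1) φ₀ = 0)
    (hv : ¬ v.asIdeal ∣ Ideal.span {(N : 𝓞 ℚ)}) (τ : ℍ) :
    ∑ j : Option (Fin (natGenerator v)), φ₀ (Rat.ofRealGL 2 (upperHalfPlaneToGL τ) * GLn.ofLocal 2 ℚ v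
      (heckeLocalRep (Rat.localUniformizer v : v.adicCompletion ℚ)
        (fun i : Fin (natGenerator v) => algebraMap ℚ (v.adicCompletion ℚ) ((i : ℕ) : ℚ))
        (Rat.localUniformizer v).ne_zero j)) =
      (∑ b ∈ Finset.range (natGenerator v),
          φ₀ (Rat.ofRealGLA (upperHalfPlaneToGL (ofComplex (((τ : ℂ) + b) / (natGenerator v : ℕ)))))) +
        χ₁ ((natGenerator v : ℕ) : ZMod N) *
          φ₀ (Rat.ofRealGLA (upperHalfPlaneToGL (ofComplex (((natGenerator v : ℕ) : ℂ) * (τ : ℂ))))) := by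
  have hp := prime_natGenerator v
  haveI : NeZero (natGenerator v) := ⟨hp.ne_zero⟩
  have hp0 : (0 : ℝ) < natGenerator v := Nat.cast_pos.mpr hp.pos
  have hpN : ¬ natGenerator v ∣ N := fun h => hv ((Rat.natGenerator_dvd_iff v N).1 h)
  obtain ⟨a, b', d', had, hap⟩ := exists_bezout_level N (natGenerator v) hp hpN
  have hslash : ∀ γ : SL(2, ℤ), γ ∈ CongruenceSubgroup.Gamma0 N → ∀ z : ℍ,
      φ₀ (Rat.ofRealGLA (upperHalfPlaneToGL (γ • z))) =
        χ₁ (((γ : Matrix (Fin 2) (Fin 2) ℤ) 1 1 : ℤ) : ZMod N) * φ₀ (Rat.ofRealGLA (upperHalfPlaneToGL z)) :=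
    fun γ hγ z => descent_slash χ₁ hcusp hK hcen hs hw hZ γ hγ z
  -- positivity of determinants
  have hβ : ∀ j, 0 < ((heckeBeta (natGenerator v) a b' d' N hp.ne_zero had j).det : ℚ) := fun j => by
    rw [val_det_heckeBeta]; exact_mod_cast hp.pos
  have hdet : ∀ j, 0 < ((Matrix.GeneralLinearGroup.map (Rat.castHom ℝ)
      (heckeBeta (natGenerator v) a b' d' N hp.ne_zero had j))⁻¹ * upperHalfPlaneToGL τ).det.val := fun j => by
    rw [map_mul, map_inv, Units.val_mul, Units.val_inv_eq_inv_val, Matrix.GeneralLinearGroup.map_det, Units.coe_map,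
      MonoidHom.coe_coe, val_det_heckeBeta, Rat.coe_castHom, Rat.cast_natCast, det_upperHalfPlaneToGL]
    exact mul_pos (inv_pos.2 hp0) τ.im_pos
  -- each term through `βⱼ`
  have hterm : ∀ j, φ₀ (Rat.ofRealGL 2 (upperHalfPlaneToGL τ) * GLn.ofLocal 2 ℚ v
      (heckeLocalRep (Rat.localUniformizer v : v.adicCompletion ℚ)
        (fun i : Fin (natGenerator v) => algebraMap ℚ (v.adicCompletion ℚ) ((i : ℕ) : ℚ))
        (Rat.localUniformizer v).ne_zero j)) =
      φ₀ (Rat.ofRealGLA (upperHalfPlaneToGL (((Matrix.GeneralLinearGroup.map (Rat.castHom ℝ)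
        (heckeBeta (natGenerator v) a b' d' N hp.ne_zero had j))⁻¹ * upperHalfPlaneToGL τ) • UpperHalfPlane.I))) :=
    fun j => by
    rw [apply_ofRealGL_mul_eq_of_matching hcusp hK (det_upperHalfPlaneToGL_pos τ) (hβ j)
      (Rat.archGL_ofLocal_heckeLocalRep j) (Rat.globalToLocal_heckeBeta_inv_mul_mem_localGammaOne hv had hap j)]
    exact apply_ofRealGL_eq hs hw hZ (hdet j)
  -- the points `βⱼ⁻¹ τ`
  have hsome : ∀ j : Fin (natGenerator v), ((Matrix.GeneralLinearGroup.map (Rat.castHom ℝ)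
      (heckeBeta (natGenerator v) a b' d' N hp.ne_zero had (some j)))⁻¹ * upperHalfPlaneToGL τ) • UpperHalfPlane.I =
      (tpB (natGenerator v) (-((j : ℕ) : ℤ)) : GL (Fin 2) ℝ) • τ := fun j => by
    have htB : 0 < (tpB (natGenerator v) (-((j : ℕ) : ℤ)) * upperHalfPlaneToGL τ : GL (Fin 2) ℝ).det.val := by
      rw [map_mul, Units.val_mul, Matrix.GeneralLinearGroup.val_det_apply, val_tpB, Matrix.det_fin_two_of,
        det_upperHalfPlaneToGL]
      simp only [mul_zero, sub_zero, one_mul]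
      exact mul_pos hp0 τ.im_pos
    rw [map_castHom_heckeBeta_some_inv (natGenerator v) hp a b' d' had j, mul_assoc, realScalarGL_mul_smul _ _ htB,
      mul_smul, upperHalfPlaneToGL_smul_I]
  have hnone : ((Matrix.GeneralLinearGroup.map (Rat.castHom ℝ)
      (heckeBeta (natGenerator v) a b' d' N hp.ne_zero had none))⁻¹ * upperHalfPlaneToGL τ) • UpperHalfPlane.I =
      ((bezoutDelta a b' d' N had)⁻¹ : SL(2, ℤ)) • ((tpD (natGenerator v) : GL (Fin 2) ℝ) • τ) := by
    have htD : 0 < ((((bezoutDelta a b' d' N had)⁻¹ : SL(2, ℤ)) : GL (Fin 2) ℝ) * tpD (natGenerator v) *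
        upperHalfPlaneToGL τ : GL (Fin 2) ℝ).det.val := by
      rw [map_mul, map_mul, Units.val_mul, Units.val_mul, val_det_coe_GL, one_mul, Matrix.GeneralLinearGroup.val_det_apply,
        val_tpD, Matrix.det_fin_two_of, det_upperHalfPlaneToGL]
      simp only [mul_one, mul_zero, sub_zero]
      exact mul_pos hp0 τ.im_pos
    rw [map_castHom_heckeBeta_none_inv (natGenerator v) hp a b' d' had, mul_assoc, realScalarGL_mul_smul _ _ htD,
      mul_smul, mul_smul, upperHalfPlaneToGL_smul_I, ModularGroup.sl_moeb]
  -- assemble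
  rw [Fintype.sum_option, hterm, hnone, hslash _ (bezoutDelta_inv_mem_gamma0 a b' d' N had),
    bezoutDelta_inv_apply_one_one, tpD_smul_eq]
  simp_rw [hterm, hsome]
  rw [sum_apply_tpB_neg_smul (u := fun z : ℍ => φ₀ (Rat.ofRealGLA (upperHalfPlaneToGL z))) hslash τ,
    ← Finset.sum_range fun b => φ₀ (Rat.ofRealGLA (upperHalfPlaneToGL ((tpB (natGenerator v) (b : ℤ) : GL (Fin 2) ℝ) • τ)))]
  simp_rw [tpB_smul_eq, Int.cast_natCast]
  have hχ : χ₁ ((a : ℤ) : ZMod N) = χ₁ ((natGenerator v : ℕ) : ZMod N) := by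
    congr 1
    rw [← Int.cast_natCast]
    exact ((ZMod.intCast_eq_intCast_iff_dvd_sub (natGenerator v : ℤ) a N).2 hap).symm
  rw [hχ, add_comm]

/-- **`T_{v,1} φ₀ = c₁ φ₀` descends to `T_p u = (c₁/√p) u`**: the Hecke operator
`[K(N) diag(ϖ,1)_v K(N)]` on the `K(N)`-fixed vector `φ₀` is `∑ⱼ r(yⱼ)` over the transversal
`{yⱼ}` (`heckeOperator_apply_eq_sum`, `Rat.bijOn_range_ofLocal_heckeLocalRep`); at `(g_τ, 1)` the sum
is `√p (T_p u)(τ)` (`sum_apply_ofRealGL_mul_heckeLocalRep`, `maassHeckeOp_prime`).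
[cite: Gelbart1975, §3.B, (3.15) and Lemma 3.7] [cite: BookerLeeStrombergsson2020, §1.1] -/
theorem descent_hecke_one (χ₁ : DirichletCharacter ℂ N) (hcusp : φ₀ ∈ cuspFormsGL 2 ℚ hcpt)
    (hK : ∀ u ∈ gammaOneFiniteLevel ℚ (Ideal.span {(N : 𝓞 ℚ)}),
      rightTranslation (AdelicGroupData.gl 2 ℚ) (show (AdelicGroupData.gl 2 ℚ).Adelic from GLn.ofFinite 2 ℚ u) φ₀ = φ₀)
    (hcen : ∀ z : ideleGroup ℚ,
      rightTranslation (AdelicGroupData.gl 2 ℚ) (Matrix.GeneralLinearGroup.scalar (Fin 2) z) φ₀ =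
        ((HeckeCharacter.ofDirichlet χ₁ z : ℂˣ) : ℂ) • φ₀)
    (hs : IsArchSmooth Rat.iotaA φ₀) (hw : IsWeightVec Rat.iotaA 0 φ₀) (hZ : lieDeriv Rat.iotaA (toLie 1) φ₀ = 0)
    (hv : ¬ v.asIdeal ∣ Ideal.span {(N : 𝓞 ℚ)}) {c₁ : ℂ}
    (hT : heckeOperator (rightTranslation (AdelicGroupData.gl 2 ℚ))
        (show Subgroup (AdelicGroupData.gl 2 ℚ).Adelic from principalCongruenceLevel 2 ℚ (Ideal.span {(N : 𝓞 ℚ)}))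
        (heckeDiagAt 2 ℚ v (Rat.localUniformizer v) 1) φ₀ = c₁ • φ₀) (τ : ℍ) :
    maassHeckeOp N χ₁ (natGenerator v) (fun τ : ℍ => φ₀ (Rat.ofRealGLA (upperHalfPlaneToGL τ))) τ =
      (c₁ / ((Real.sqrt (natGenerator v : ℝ) : ℝ) : ℂ)) * φ₀ (Rat.ofRealGLA (upperHalfPlaneToGL τ)) := by
  classical
  have h𝔫 : Ideal.span {(N : 𝓞 ℚ)} ≠ 0 := Rat.span_natCast_ne_zero N
  obtain ⟨hU1, hU2, hU3⟩ := principalCongruenceLevel_local_hyps (n := 2) (K := ℚ) (v := v) h𝔫 hv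
  set Kn : Subgroup (AdelicGroupData.gl 2 ℚ).Adelic := principalCongruenceLevel 2 ℚ (Ideal.span {(N : 𝓞 ℚ)}) with hKn
  set y : Option (Fin (natGenerator v)) → (AdelicGroupData.gl 2 ℚ).Adelic := fun j => GLn.ofLocal 2 ℚ v
    (heckeLocalRep (Rat.localUniformizer v : v.adicCompletion ℚ)
      (fun i : Fin (natGenerator v) => algebraMap ℚ (v.adicCompletion ℚ) ((i : ℕ) : ℚ))
      (Rat.localUniformizer v).ne_zero j) with hy
  have hinj : Function.Injective y := Rat.ofLocal_heckeLocalRep_injective hv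
  have hbij : Set.BijOn (fun x : (AdelicGroupData.gl 2 ℚ).Adelic => (x : (AdelicGroupData.gl 2 ℚ).Adelic ⧸ Kn))
      ↑(Finset.univ.image y) (MulAction.orbit Kn
        (QuotientGroup.mk (s := Kn) (heckeDiagAt 2 ℚ v (Rat.localUniformizer v) 1))) := by
    have h := Rat.bijOn_range_ofLocal_heckeLocalRep hU1 hU2 hU3
    rwa [Finset.coe_image, Finset.coe_univ, Set.image_univ]
  have hsum := congrFun hT (Rat.ofRealGL 2 (upperHalfPlaneToGL τ))
  rw [heckeOperator_apply_eq_sum _ Kn _ _ hbij (mem_fixedPoints_principalCongruenceLevel hK),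
    Finset.sum_image (fun i _ j _ h => hinj h), Finset.sum_apply, Pi.smul_apply, smul_eq_mul] at hsum
  simp only [rightTranslation_apply, hy] at hsum
  -- `Σ_b u((τ+b)/p) + χ₁(p) u(pτ) = c₁ u(τ)`
  have hsum' : (∑ b ∈ Finset.range (natGenerator v),
      φ₀ (Rat.ofRealGLA (upperHalfPlaneToGL (ofComplex (((τ : ℂ) + b) / (natGenerator v : ℕ)))))) +
        χ₁ ((natGenerator v : ℕ) : ZMod N) *
          φ₀ (Rat.ofRealGLA (upperHalfPlaneToGL (ofComplex (((natGenerator v : ℕ) : ℂ) * (τ : ℂ))))) =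
      c₁ * φ₀ (Rat.ofRealGLA (upperHalfPlaneToGL τ)) := by
    rw [← sum_apply_ofRealGL_mul_heckeLocalRep χ₁ hcusp hK hcen hs hw hZ hv τ]
    exact hsum
  have hsp : ((Real.sqrt (natGenerator v : ℝ) : ℝ) : ℂ) ≠ 0 := by
    exact_mod_cast (Real.sqrt_pos.2 (Nat.cast_pos.mpr (prime_natGenerator v).pos)).ne'
  rw [maassHeckeOp_prime N χ₁ (prime_natGenerator v), hsum']
  field_simp

/-- **`T_{v,2} φ₀ = c₂ φ₀` forces `c₂ = χ₁(p)`** for `φ₀ ≠ 0`. [cite: Bump1997, §3.6, (6.4)] -/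
theorem descent_hecke_two (χ₁ : DirichletCharacter ℂ N) (hne : φ₀ ≠ 0)
    (hK : ∀ u ∈ gammaOneFiniteLevel ℚ (Ideal.span {(N : 𝓞 ℚ)}),
      rightTranslation (AdelicGroupData.gl 2 ℚ) (show (AdelicGroupData.gl 2 ℚ).Adelic from GLn.ofFinite 2 ℚ u) φ₀ = φ₀)
    (hcen : ∀ z : ideleGroup ℚ,
      rightTranslation (AdelicGroupData.gl 2 ℚ) (Matrix.GeneralLinearGroup.scalar (Fin 2) z) φ₀ =
        ((HeckeCharacter.ofDirichlet χ₁ z : ℂˣ) : ℂ) • φ₀)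
    (hv : ¬ v.asIdeal ∣ Ideal.span {(N : 𝓞 ℚ)}) {c₂ : ℂ}
    (hT : heckeOperator (rightTranslation (AdelicGroupData.gl 2 ℚ))
        (show Subgroup (AdelicGroupData.gl 2 ℚ).Adelic from principalCongruenceLevel 2 ℚ (Ideal.span {(N : 𝓞 ℚ)}))
        (heckeDiagAt 2 ℚ v (Rat.localUniformizer v) 2) φ₀ = c₂ • φ₀) :
    c₂ = χ₁ ((natGenerator v : ℕ) : ZMod N) := by
  rw [heckeOperator_two_eq_smul χ₁ hK hcen hv] at hT
  have h : (χ₁ ((natGenerator v : ℕ) : ZMod N) - c₂) • φ₀ = 0 := by rw [sub_smul, hT, sub_self]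
  rcases smul_eq_zero.1 h with h0 | h0
  · exact (sub_eq_zero.1 h0).symm
  · exact absurd h0 hne

/-- **Registered sub-goal `stub_descent_hecke` of `stub_descent`**: the unramified Hecke operators
`T_{v,1}`, `T_{v,2}` of `HasSatakeParamAt` on the weight-`0` vector `φ₀` descend to
`T_p u = (c₁/√p) u` (`maassHeckeOp`) and `c₂ = χ₁(p)`. [cite: Gelbart1975, §3.B, Lemma 3.7]
[cite: Bump1997, §3.6] -/
theorem stub_descent_hecke : ∀ (hcpt : isCompact_glFiniteIntegralLevel 2 ℚ) (N : ℕ) [NeZero N] (χ₁ : DirichletCharacter ℂ N) (φ₀ : (AdelicGroupData.gl 2 ℚ).Adelic → ℂ), φ₀ ∈ cuspFormsGL 2 ℚ hcpt → φ₀ ≠ 0 → (∀ u ∈ gammaOneFiniteLevel ℚ (Ideal.span {(N : 𝓞 ℚ)}), rightTranslation (AdelicGroupData.gl 2 ℚ) (show (AdelicGroupData.gl 2 ℚ).Adelic from GLn.ofFinite 2 ℚ u) φ₀ = φ₀) → (∀ z : ideleGroup ℚ, rightTranslation (AdelicGroupData.gl 2 ℚ) (Matrix.GeneralLinearGroup.scalar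 (Fin 2) z) φ₀ = ((HeckeCharacter.ofDirichlet χ₁ z : ℂˣ) : ℂ) • φ₀) → IsArchSmooth Rat.iotaA φ₀ → IsWeightVec Rat.iotaA 0 φ₀ → lieDeriv Rat.iotaA (toLie 1) φ₀ = 0 → ∀ v : HeightOneSpectrum (𝓞 ℚ), ¬ v.asIdeal ∣ Ideal.span {(N : 𝓞 ℚ)} → ∀ c₁ c₂ : ℂ, heckeOperator (rightTranslation (AdelicGroupData.gl 2 ℚ)) (show Subgroup (AdelicGroupData.gl 2 ℚ).Adelic from principalCongruenceLevel 2 ℚ (Ideal.span {(N : 𝓞 ℚ)})) (heckeDiagAt 2 ℚ v (Rat.localUniformizer v) 1) φ₀ = c₁ • φ₀ → heckeOperator (rightTranslation (AdelicGroupData.gl 2 ℚ)) (show Subgroup (AdelicGroupData.gl 2 ℚ).Adelic from principalCongruenceLevel 2 ℚ (Ideal.span {(N : 𝓞 ℚ)})) (heckeDiagAt 2 ℚ v (Rat.localUniformizer v) 2) φ₀ = c₂ • φ₀ → (∀ z : UpperHalfPlane, maassHeckeOp N χ₁ (natGenerator v) (fun τ : UpperHalfPlane => φ₀ (Rat.ofRealGLA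 (upperHalfPlaneToGL τ))) z = (c₁ / (((Real.sqrt (natGenerator v : ℝ)) : ℝ) : ℂ)) * φ₀ (Rat.ofRealGLA (upperHalfPlaneToGL z))) ∧ c₂ = χ₁ ((natGenerator v : ℕ) : ZMod N) :=
  fun _ _ _ χ₁ _ hcusp hne hK hcen hs hw hZ _ hv _ _ hT1 hT2 =>
    ⟨fun z => descent_hecke_one χ₁ hcusp hK hcen hs hw hZ hv hT1 z, descent_hecke_two χ₁ hne hK hcen hv hT2⟩

end HeckeOne

end Summit.Langlands.Langlands.Theorems.CorrespondentFingerprint
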